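import Summits.Ventures.PercRepro2.CaseOnePairPocketB
import Summits.Ventures.PercRepro2.CaseOneNullEdgeClasses

/-!
# The roots-and-`b` class at every multiplicity is closed (blind cell PercRepro2, p1 g29;
S5 §2.3, the row «roots + one edge to `b`» CLOSED on all four forms in general)

**`closedAt_of_rootsAndB`**: a statement vertex `a₃` whose edges go to `a₁` and to `a₂` (any
multiplicities, possibly none) and to `b` through exactly one edge `eb` is closed — all four forms
`(ii)`, `(ii-Q)`, `(i)`, `(i-Q)` for every weight vector. Strong induction on the number of edges: a
parallel pair at `a₃` whose removed member is not `eb` merges by the parallel thickening step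
(`ThickStep.par`, `closedAt_of_thickStep`), the class description passing to the subtype graph; when
the ends of the edges at `a₃` are pairwise distinct the graph is one of the four single-edge bases —
`a₃ ~ {a₁, a₂, b}` (`closedAt_of_rootsAndB_single`), `a₃ ~ {a₁, b}` / `a₃ ~ {a₂, b}`
(`closedAt_of_a1b` / `closedAt_of_a2b`), or the leaf at `b` (the pendant step from the mark `b`,
`closedAt_of_moves_mark`). Corollaries: `fourForms_of_rootsAndB` and the `(i-Q)` entry of the row at
every multiplicity, **`zSplitIQ_of_rootsAndB`** (the single-edge restriction of p1 g28 removed).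
Own code; standard axioms.
-/

namespace Summit.Ventures.PercRepro2

namespace CaseOne

universe u

section Mult
variable {V : Type*} [Fintype V] [DecidableEq V] {R : Type*} [Field R] [LinearOrder R]
  [IsStrictOrderedRing R]
variable {o a₁ a₂ a₃ b : V}

/-- **The roots-and-`b` class at every multiplicity is closed** (the induction, over the number of
edges): edges at `a₃` to `a₁`, to `a₂` (any multiplicities) and one edge `eb` to `b`. -/
theorem closedAt_of_rootsAndB_aux (h1 : a₁ ≠ a₃) (h2 : a₂ ≠ a₃) (ho : o ≠ a₃) (hb : b ≠ a₃) :
    ∀ (n : ℕ) (E : Type u) [Fintype E] [DecidableEq E] (ends : E → Sym2 V) (eb : E),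
      Fintype.card E = n → ends eb = s(b, a₃) →
      (∀ e, a₃ ∈ ends e → e ≠ eb → ends e = s(a₁, a₃) ∨ ends e = s(a₂, a₃)) →
      ClosedAt R o a₁ a₂ b E ends a₃ := by
  intro n
  induction n using Nat.strong_induction_on with
  | _ n ih =>
    intro E _ _ ends eb hn heb hroot
    by_cases hpar : ∃ e₀ e₁ : E, e₀ ≠ e₁ ∧ e₁ ≠ eb ∧ ends e₀ = ends e₁ ∧ a₃ ∈ ends e₁
    · -- a parallel pair at `a₃`, the removed edge `e₁ ≠ eb`: merge it
      obtain ⟨e₀, e₁, hne, hne_b, hpar, -⟩ := hpar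
      have hlt : Fintype.card {e : E // e ≠ e₁} < n :=
        hn ▸ Fintype.card_subtype_lt (x := e₁) (by simp)
      refine closedAt_of_thickStep (ThickStep.par E ends e₀ e₁ hpar hne) ?_
      refine ih _ hlt {e : E // e ≠ e₁} (restrictEnds ends e₁) ⟨eb, hne_b.symm⟩ rfl heb ?_
      intro e he hne'
      exact hroot e.1 he fun h => hne' (Subtype.ext h)
    · -- the ends of the edges at `a₃` are pairwise distinct
      push Not at hpar
      have hinj : ∀ e e', a₃ ∈ ends e → ends e = ends e' → e = e' := by
        intro e e' he hee'
        by_contra hne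
        by_cases h' : e' = eb
        · subst h'
          exact hpar e' e (Ne.symm hne) hne hee'.symm he
        · exact hpar e e' hne h' hee' (hee' ▸ he)
      by_cases hf₁ : ∃ f, f ≠ eb ∧ ends f = s(a₁, a₃)
      · obtain ⟨f₁, hf₁b, hf₁⟩ := hf₁
        by_cases hf₂ : ∃ f, f ≠ eb ∧ ends f = s(a₂, a₃)
        · obtain ⟨f₂, hf₂b, hf₂⟩ := hf₂
          by_cases h12 : f₁ = f₂
          · -- the roots coincide on this edge: `a₃ ~ {a₁, b}`
            subst h12
            refine closedAt_of_a1b hf₁ heb hf₁b ?_ h1 h2 ho hb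
            intro e he
            by_cases heb' : e = eb
            · exact Or.inr heb'
            · rcases hroot e he heb' with h | h
              · exact Or.inl (hinj e f₁ he (h.trans hf₁.symm))
              · exact Or.inl (hinj e f₁ he (h.trans hf₂.symm))
          · -- `a₃ ~ {a₁, a₂, b}` through single edges
            refine closedAt_of_rootsAndB_single hf₁ hf₂ heb h12 hf₁b hf₂b ?_ h1 h2 ho hb
            intro e he
            by_cases heb' : e = eb
            · exact Or.inr (Or.inr heb')
            · rcases hroot e he heb' with h | h
              · exact Or.inl (hinj e f₁ he (h.trans hf₁.symm))
              · exact Or.inr (Or.inl (hinj e f₂ he (h.trans hf₂.symm)))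
        · -- `a₃ ~ {a₁, b}` through single edges
          push Not at hf₂
          refine closedAt_of_a1b hf₁ heb hf₁b ?_ h1 h2 ho hb
          intro e he
          by_cases heb' : e = eb
          · exact Or.inr heb'
          · rcases hroot e he heb' with h | h
            · exact Or.inl (hinj e f₁ he (h.trans hf₁.symm))
            · exact absurd h (hf₂ e heb')
      · push Not at hf₁
        by_cases hf₂ : ∃ f, f ≠ eb ∧ ends f = s(a₂, a₃)
        · -- `a₃ ~ {a₂, b}` through single edges
          obtain ⟨f₂, hf₂b, hf₂⟩ := hf₂
          refine closedAt_of_a2b hf₂ heb hf₂b ?_ h1 h2 ho hb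
          intro e he
          by_cases heb' : e = eb
          · exact Or.inr heb'
          · rcases hroot e he heb' with h | h
            · exact absurd h (hf₁ e heb')
            · exact Or.inl (hinj e f₂ he (h.trans hf₂.symm))
        · -- `a₃` is a leaf at the mark `b`: the pendant step from `b`
          push Not at hf₂
          have hl : IsLeafAt ends b a₃ eb :=
            { ends_eq := heb
              unique := fun e he => by
                by_contra heb'
                rcases hroot e he heb' with h | h
                · exact hf₁ e heb' h
                · exact hf₂ e heb' h
              ne := hb }
          exact closedAt_of_moves_mark o a₁ a₂ b (E' := {e : E // e ≠ eb})
            (ends' := restrictEnds ends eb) (v' := b) (Or.inr (Or.inr (Or.inr rfl)))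
            (Moves.tail (Moves.refl _ _ _) (MoveStep.leafMove E ends b a₃ eb hl ho h1 h2 hb))

/-- **The roots-and-`b` class at every multiplicity is closed**: `a₃` adjacent to `a₁` and to `a₂`
through any numbers of edges (possibly none) and to `b` through exactly one edge has all four forms
for every weight vector. -/
theorem closedAt_of_rootsAndB {E : Type u} [Fintype E] [DecidableEq E] {ends : E → Sym2 V} {eb : E}
    (heb : ends eb = s(b, a₃))
    (hroot : ∀ e, a₃ ∈ ends e → e ≠ eb → ends e = s(a₁, a₃) ∨ ends e = s(a₂, a₃))
    (h1 : a₁ ≠ a₃) (h2 : a₂ ≠ a₃) (ho : o ≠ a₃) (hb : b ≠ a₃) : ClosedAt R o a₁ a₂ b E ends a₃ :=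
  closedAt_of_rootsAndB_aux h1 h2 ho hb _ E ends eb rfl heb hroot

/-- All four forms for one weight vector on the roots-and-`b` class at every multiplicity. -/
theorem fourForms_of_rootsAndB {E : Type u} [Fintype E] [DecidableEq E] {ends : E → Sym2 V} {eb : E}
    (p : E → R) (hp : IsProbVec p) (heb : ends eb = s(b, a₃))
    (hroot : ∀ e, a₃ ∈ ends e → e ≠ eb → ends e = s(a₁, a₃) ∨ ends e = s(a₂, a₃))
    (h1 : a₁ ≠ a₃) (h2 : a₂ ≠ a₃) (ho : o ≠ a₃) (hb : b ≠ a₃) : FourForms p ends o a₁ a₂ a₃ b :=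
  closedAt_of_rootsAndB heb hroot h1 h2 ho hb p hp

/-- **`(i-Q)` for the roots-and-`b` class at every multiplicity** — the `(i-Q)` entry of the row
«roots + one edge to `b`» without the single-edge restriction. -/
theorem zSplitIQ_of_rootsAndB {E : Type u} [Fintype E] [DecidableEq E] {ends : E → Sym2 V} {eb : E}
    (p : E → R) (hp : IsProbVec p) (heb : ends eb = s(b, a₃))
    (hroot : ∀ e, a₃ ∈ ends e → e ≠ eb → ends e = s(a₁, a₃) ∨ ends e = s(a₂, a₃))
    (h1 : a₁ ≠ a₃) (h2 : a₂ ≠ a₃) (ho : o ≠ a₃) (hb : b ≠ a₃) : ZSplitIQ p ends o a₁ a₂ a₃ b :=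
  (fourForms_of_rootsAndB p hp heb hroot h1 h2 ho hb).2.2.2

end Mult

end CaseOne

end Summit.Ventures.PercRepro2
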